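import Literature.Analysis.FluidPDE.LocalEnergyExtension
import Literature.Analysis.FluidPDE.LocalEnergyUnitExistence
import HarnessLib

/-!
# Discharge of `localEnergySolution_extension_of_memE2` (**F2**)

Analysis/FluidPDE theorem file (no definitions, no named facts): the named fact
`localEnergySolution_extension_of_memE2` of `LocalEnergyExtension.lean` — "a local energy solution
on `ℝ³ × (0, T₀)` whose datum is in `E̊₃` extends to a local energy solution on `ℝ³ × (0, T)` for
every `T > T₀`" (Seregin 2014, App. B, the remark after Prop. 1.5; Lemarié-Rieusset 2016,
Thm. 14.8) — is proved: the tree's reduction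
`localEnergySolution_extension_of_memE2_of_unitExistence` (slice regularity (B.1.17) + concatenation
of local energy solutions) leaves exactly the unit-time existence of local energy solutions for
weakly divergence-free `E̊₃` data, which is `localEnergySolution_exists_unit_of_memE3`
(`LocalEnergyUnitExistence.lean`: Leray's weak solutions are local energy solutions, the uniformly
local small-data mild solution, the perturbed energy inequality with Grönwall, the limiting
procedure, and the initial condition of the limit).

The discharge lives in this sibling file rather than in `LocalEnergyExtension.lean` itself because
the proof imports `NSSereginMildProp151.lean` (every-time local energy bounds from a.e. bounds),
which imports `LocalEnergyExtension.lean`.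

## References

* G. Seregin, *Lecture Notes on Regularity Theory for the Navier–Stokes Equations* (2014), App. B,
  Prop. 1.5 and the remark following it; §B.5.
* P. G. Lemarié-Rieusset, *The Navier–Stokes Problem in the 21st Century* (2016), Thm. 14.8.
-/

namespace Literature.Analysis.FluidPDE

/-- **F2 holds**: extension of local energy solutions with `E̊₃` data past any finite time
(Seregin 2014, App. B, remark after Prop. 1.5; Lemarié-Rieusset 2016, Thm. 14.8), by the tree's
reduction to unit-time existence (`localEnergySolution_extension_of_memE2_of_unitExistence`) and the
unit-time existence theorem `localEnergySolution_exists_unit_of_memE3`.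
[cite: Seregin2014Notes, App. B Prop. 1.5 and remark; §B.5] [cite: LemarieRieusset2016, Thm. 14.8] -/
theorem localEnergySolution_extension_of_memE2_holds : localEnergySolution_extension_of_memE2 :=
  localEnergySolution_extension_of_memE2_of_unitExistence localEnergySolution_exists_unit_of_memE3

end Literature.Analysis.FluidPDE
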